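import Mathlib
import Summits.Ventures.HodgeRepro.Tier4.Target
import Summits.Ventures.HodgeRepro.Tier4.Line3.KMDatum
import Summits.Ventures.HodgeRepro.Tier4.Line3.KMDatumS

/-!
# Tier4/Line3/Witness/PhiDel — the `∂`-datum `Φ_∂`, the Φ-side R4 witness of LINE L3's `ThetaData` (clauses `cont`,
`growth` of `KMDatumS`, and `nondeg`)
(seat t4-L2-p2, gen 0, on t4-plan-3's word S12460 (ii); blind re-derivation cell `pub-hodge-repro`, Tier 4, README §9–§10)

`Φ_∂` is the Kudla–Millson datum `∂_z e^{−π maj}`: its coefficient matrices are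
`A_k(z) = −2π [(1 − |z|²)⁻¹ e_k (J w_z)^* + (1 − |z|²)⁻² conj z_k (J w_z)(J w_z)^*]`, `w_z = lift3 z`, so that
`ȳ A_k(z) y = −2π [d conj y_k ℓ + d² conj z_k |ℓ|²]` (`quad_Adel`; `d = (1 − |z|²)⁻¹`, `ℓ = ℓ_z(y) = (J w_z)^* y`)
is `∂_{z_k}(−π maj y z)`.

* `PhiDel : KMDatumS` — `cont` (`Adel_continuousOn`: rational in `z, z̄` with denominator `1 − |z|² ≠ 0` on the ball),
  `growth` (`Adel_growth`: `‖A_k(z)_{ij}‖ ≤ 4π / (1 − |z|²)²`, every entry of `J w_z` and of `z` has norm `≤ 1` on the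
  ball);
* `wedge_datumS_PhiDel` — the wedge of two `∂`-data factorises as `E_a E_b · 4π² d² · ℓ_a ℓ_b · D(z)` with
  `D(z) = conj (a₀ b₁ − a₁ b₀) + d [conj ℓ_b (conj a₀ conj z₁ − conj a₁ conj z₀) + conj ℓ_a (conj z₀ conj b₁ − conj z₁ conj b₀)]`;
* `PhiDel_nondeg` — the `nondeg` clause: for `a, b` with `a₀ b₁ − a₁ b₀ ≠ 0` there is a direction `ζ` with
  `ζ^* a_{01} ≠ 0 ≠ ζ^* b_{01}` (`exists_direction`), and along the small real multiples `t ζ` the factors `ℓ_a`, `ℓ_b`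
  are eventually non-zero while `D(t ζ) → conj (a₀ b₁ − a₁ b₀) ≠ 0`, so the wedge is non-zero at some `t ζ` in the ball.

The `equiv` clause (the `U(2,1)`-equivariance of `Φ_∂`, the chain rule for the holomorphic `actM M` applied to
`maj (M y) (actM M z) = maj y z`) is a separate module.  Mathlib + the target's definitions; no printed input.
Nothing here says anything about the status of the Hodge conjecture for CM abelian varieties, which is NOT proved
(HC_CM is NOT proved by anyone in this repository).
-/

set_option autoImplicit false

noncomputable section

namespace Summit.Ventures.HodgeRepro.Tier4.Line3

open Summit.Ventures.HodgeRepro.Tier4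
open Matrix
open scoped ComplexConjugate

/-- `J w_z = (z₀, z₁, −1)` for `w_z = lift3 z`. -/
def Jw (z : Fin 2 → ℂ) : Fin 3 → ℂ := J *ᵥ lift3 z

/-- `J w_z = (z₀, z₁, −1)` in coordinates. -/
theorem Jw_apply (z : Fin 2 → ℂ) : Jw z = ![z 0, z 1, -1] := by
  ext i
  fin_cases i <;> simp [Jw, J, lift3, Matrix.mulVec_diagonal]

/-- The linear functional `ℓ_z(y) = (J w_z)^* y = conj z₀ y₀ + conj z₁ y₁ − y₂`. -/
def ell (z : Fin 2 → ℂ) (y : Fin 3 → ℂ) : ℂ := star (Jw z) ⬝ᵥ y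

/-- The coefficient matrices of the `∂`-datum: `A_k(z) = −2π [(1 − |z|²)⁻¹ e_k (J w_z)^* + (1 − |z|²)⁻² conj z_k (J w_z)(J w_z)^*]`,
so that `ȳ A_k(z) y = ∂_{z_k}(−π maj y z)`. -/
def Adel (z : Fin 2 → ℂ) (k : Fin 2) : Matrix (Fin 3) (Fin 3) ℂ :=
  ((-2 * Real.pi : ℝ) : ℂ) • ((((1 - nsq z)⁻¹ : ℝ) : ℂ) • vecMulVec (Pi.single (Fin.castSucc k) 1) (star (Jw z)) +
    ((((1 - nsq z)⁻¹ : ℝ) : ℂ) ^ 2 * conj (z k)) • vecMulVec (Jw z) (star (Jw z)))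

/-- The entries of `A_k(z)`. -/
theorem Adel_apply (z : Fin 2 → ℂ) (k : Fin 2) (i j : Fin 3) :
    Adel z k i j = ((-2 * Real.pi : ℝ) : ℂ) * ((((1 - nsq z)⁻¹ : ℝ) : ℂ) * ((Pi.single (Fin.castSucc k) (1 : ℂ) : Fin 3 → ℂ) i * conj (Jw z j)) +
      ((((1 - nsq z)⁻¹ : ℝ) : ℂ) ^ 2 * conj (z k)) * (Jw z i * conj (Jw z j))) := by
  simp [Adel, vecMulVec_apply, Matrix.add_apply, Matrix.smul_apply, Pi.star_apply]

/-- `0 < 1 − |z|²` on the ball. -/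
theorem one_sub_nsq_pos {z : Fin 2 → ℂ} (hz : z ∈ ball) : 0 < 1 - nsq z := by
  have : nsq z < 1 := hz
  linarith

/-- `0 ≤ |z|²`. -/
theorem nsq_nonneg (z : Fin 2 → ℂ) : 0 ≤ nsq z := by
  unfold nsq; positivity

/-- `|z|²` is continuous. -/
theorem continuous_nsq : Continuous nsq := by
  unfold nsq
  fun_prop

/-- `cont`: the entries of `A_k(z)` are continuous on the ball. -/
theorem Adel_continuousOn (k : Fin 2) (i j : Fin 3) : ContinuousOn (fun z => Adel z k i j) ball := by
  simp only [Adel_apply]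
  have h1 : ContinuousOn (fun z : Fin 2 → ℂ => ((((1 - nsq z)⁻¹ : ℝ) : ℂ))) ball := by
    refine Complex.continuous_ofReal.comp_continuousOn ?_
    refine ContinuousOn.inv₀ (continuous_const.sub continuous_nsq).continuousOn fun z hz =>
      (one_sub_nsq_pos hz).ne'
  have h2 : ∀ j, Continuous (fun z : Fin 2 → ℂ => Jw z j) := by
    intro j
    simp only [Jw_apply]
    fin_cases j <;> simp <;> fun_prop
  have h3 : Continuous (fun z : Fin 2 → ℂ => conj (z k)) := Complex.continuous_conj.comp (continuous_apply k)
  have h4 : Continuous (fun z : Fin 2 → ℂ => conj (Jw z j)) := Complex.continuous_conj.comp (h2 j)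
  exact continuousOn_const.mul (((h1.mul (continuousOn_const.mul h4.continuousOn))).add
    (((h1.pow 2).mul h3.continuousOn).mul ((h2 i).continuousOn.mul h4.continuousOn)))

/-- The entries of `J w_z` have norm `≤ 1` on the ball. -/
theorem norm_Jw_le {z : Fin 2 → ℂ} (hz : z ∈ ball) (j : Fin 3) : ‖Jw z j‖ ≤ 1 := by
  have hz' : nsq z < 1 := hz
  have h0 : ‖z 0‖ ^ 2 ≤ nsq z := by unfold nsq; nlinarith [sq_nonneg ‖z 1‖]
  have h1 : ‖z 1‖ ^ 2 ≤ nsq z := by unfold nsq; nlinarith [sq_nonneg ‖z 0‖]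
  rw [Jw_apply]
  fin_cases j
  · show ‖z 0‖ ≤ 1
    exact (pow_le_one_iff_of_nonneg (norm_nonneg _) two_ne_zero).mp (by linarith)
  · show ‖z 1‖ ≤ 1
    exact (pow_le_one_iff_of_nonneg (norm_nonneg _) two_ne_zero).mp (by linarith)
  · show ‖(-1 : ℂ)‖ ≤ 1
    simp

/-- The coordinates of a point of the ball have norm `≤ 1`. -/
theorem norm_coord_le {z : Fin 2 → ℂ} (hz : z ∈ ball) (k : Fin 2) : ‖z k‖ ≤ 1 := by
  have hz' : nsq z < 1 := hz
  have : ‖z k‖ ^ 2 ≤ nsq z := by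
    fin_cases k
    · show ‖z 0‖ ^ 2 ≤ ‖z 0‖ ^ 2 + ‖z 1‖ ^ 2
      nlinarith [sq_nonneg ‖z 1‖]
    · show ‖z 1‖ ^ 2 ≤ ‖z 0‖ ^ 2 + ‖z 1‖ ^ 2
      nlinarith [sq_nonneg ‖z 0‖]
  exact (pow_le_one_iff_of_nonneg (norm_nonneg _) two_ne_zero).mp (by linarith)

/-- `growth`: `‖A_k(z)_{ij}‖ ≤ 4π / (1 − |z|²)²` on the ball. -/
theorem Adel_growth : ∃ C m : ℝ, ∀ z ∈ ball, ∀ k i j, ‖Adel z k i j‖ ≤ C / (1 - nsq z) ^ m := by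
  refine ⟨4 * Real.pi, 2, fun z hz k i j => ?_⟩
  have hpos := one_sub_nsq_pos hz
  have hle1 : 1 - nsq z ≤ 1 := by linarith [nsq_nonneg z]
  set d : ℝ := (1 - nsq z)⁻¹ with hd
  have hd1 : 1 ≤ d := one_le_inv_iff₀.mpr ⟨hpos, hle1⟩
  have hd0 : 0 ≤ d := by linarith
  rw [Real.rpow_two, Adel_apply]
  have hA : ‖(Pi.single (Fin.castSucc k) (1 : ℂ) : Fin 3 → ℂ) i‖ ≤ 1 := by
    by_cases h : i = Fin.castSucc k
    · subst h; simp
    · simp [h]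
  have hJi := norm_Jw_le hz i
  have hJj := norm_Jw_le hz j
  have hzk := norm_coord_le hz k
  calc ‖((-2 * Real.pi : ℝ) : ℂ) * ((d : ℂ) * ((Pi.single (Fin.castSucc k) (1 : ℂ) : Fin 3 → ℂ) i * conj (Jw z j)) +
          ((d : ℂ) ^ 2 * conj (z k)) * (Jw z i * conj (Jw z j)))‖
      = 2 * Real.pi * ‖(d : ℂ) * ((Pi.single (Fin.castSucc k) (1 : ℂ) : Fin 3 → ℂ) i * conj (Jw z j)) +
          ((d : ℂ) ^ 2 * conj (z k)) * (Jw z i * conj (Jw z j))‖ := by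
        rw [norm_mul, Complex.norm_real, Real.norm_eq_abs, abs_of_neg (by linarith [Real.pi_pos])]
        ring
    _ ≤ 2 * Real.pi * (d * (1 * 1) + (d ^ 2 * 1) * (1 * 1)) := by
        gcongr
        refine (norm_add_le _ _).trans ?_
        gcongr
        · rw [norm_mul, Complex.norm_real, Real.norm_eq_abs, abs_of_nonneg hd0]
          gcongr
          rw [norm_mul, Complex.norm_conj]
          gcongr
        · rw [norm_mul, norm_mul, norm_pow, Complex.norm_real, Real.norm_eq_abs, abs_of_nonneg hd0,
            Complex.norm_conj, norm_mul, Complex.norm_conj]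
          gcongr
    _ ≤ 2 * Real.pi * (d ^ 2 + d ^ 2) := by
        gcongr
        · nlinarith
        · nlinarith
    _ = 4 * Real.pi / (1 - nsq z) ^ 2 := by
        rw [hd, inv_pow, div_eq_mul_inv]
        ring


/-- **The `∂`-datum** `Φ_∂`: the Kudla–Millson shape with `ȳ A_k(z) y = ∂_{z_k}(−π maj y z)`. -/
def PhiDel : KMDatumS where
  A := Adel
  cont := Adel_continuousOn
  growth := Adel_growth

/-- `ℓ_z(y) = conj z₀ y₀ + conj z₁ y₁ − y₂`. -/
theorem ell_eq (z : Fin 2 → ℂ) (y : Fin 3 → ℂ) : ell z y = conj (z 0) * y 0 + conj (z 1) * y 1 - y 2 := by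
  simp [ell, Jw_apply, dotProduct, Fin.sum_univ_three]
  ring

/-- The quadratic form of `A_k(z)`: `ȳ A_k(z) y = −2π [d conj y_k ℓ + d² conj z_k |ℓ|²]`, `d = (1 − |z|²)⁻¹`, `ℓ = ℓ_z(y)`. -/
theorem quad_Adel (z : Fin 2 → ℂ) (k : Fin 2) (y : Fin 3 → ℂ) :
    star y ⬝ᵥ (Adel z k *ᵥ y) =
      ((-2 * Real.pi : ℝ) : ℂ) * ((((1 - nsq z)⁻¹ : ℝ) : ℂ) * (conj (y (Fin.castSucc k)) * ell z y) +
        ((((1 - nsq z)⁻¹ : ℝ) : ℂ) ^ 2 * conj (z k)) * (conj (ell z y) * ell z y)) := by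
  simp only [ell_eq, map_add, map_sub, map_mul, Complex.conj_conj]
  fin_cases k <;>
  · simp [Adel, Matrix.mulVec, dotProduct, Fin.sum_univ_three, vecMulVec_apply, Jw_apply]
    ring

/-- The datum of `Φ_∂` in closed form. -/
theorem datumS_PhiDel (y : Fin 3 → ℂ) (z : Fin 2 → ℂ) (k : Fin 2) :
    datumS PhiDel y z k =
      ((-2 * Real.pi : ℝ) : ℂ) * ((((1 - nsq z)⁻¹ : ℝ) : ℂ) * (conj (y (Fin.castSucc k)) * ell z y) +
        ((((1 - nsq z)⁻¹ : ℝ) : ℂ) ^ 2 * conj (z k)) * (conj (ell z y) * ell z y)) *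
      ((Real.exp (-Real.pi * maj y z) : ℝ) : ℂ) := by
  unfold datumS
  rw [show PhiDel.A = Adel from rfl, quad_Adel]

/-- The `D`-factor of the wedge of two `∂`-data. -/
def Dfac (a b : Fin 3 → ℂ) (z : Fin 2 → ℂ) : ℂ :=
  conj (a 0 * b 1 - a 1 * b 0) + (((1 - nsq z)⁻¹ : ℝ) : ℂ) *
    (conj (ell z b) * (conj (a 0) * conj (z 1) - conj (a 1) * conj (z 0)) +
      conj (ell z a) * (conj (z 0) * conj (b 1) - conj (z 1) * conj (b 0)))

/-- The wedge of two `∂`-data factorises: `Φ_∂(a) ∧ Φ_∂(b) = E_a E_b · 4π² d² · ℓ_a ℓ_b · D`. -/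
theorem wedge_datumS_PhiDel (a b : Fin 3 → ℂ) (z : Fin 2 → ℂ) :
    wedge (datumS PhiDel a z) (datumS PhiDel b z) =
      ((Real.exp (-Real.pi * maj a z) : ℝ) : ℂ) * ((Real.exp (-Real.pi * maj b z) : ℝ) : ℂ) *
        ((4 * Real.pi ^ 2 : ℝ) : ℂ) * ((((1 - nsq z)⁻¹ : ℝ) : ℂ)) ^ 2 * (ell z a * ell z b) * Dfac a b z := by
  unfold wedge
  rw [datumS_PhiDel, datumS_PhiDel, datumS_PhiDel, datumS_PhiDel]
  unfold Dfac
  simp only [map_sub, map_mul, Fin.castSucc_zero, Fin.castSucc_one]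
  push_cast
  ring


/-! ### `nondeg`: a direction `ζ` and a small real multiple `t ζ` where the wedge is non-zero -/

/-- A direction `ζ ∈ ℂ²` on which both linear forms `a_{01}`, `b_{01}` (independent) are non-zero. -/
theorem exists_direction (a b : Fin 3 → ℂ) (hab : a 0 * b 1 - a 1 * b 0 ≠ 0) :
    ∃ ζ : Fin 2 → ℂ, conj (ζ 0) * a 0 + conj (ζ 1) * a 1 ≠ 0 ∧ conj (ζ 0) * b 0 + conj (ζ 1) * b 1 ≠ 0 := by
  by_cases h0 : a 0 * b 0 ≠ 0
  · refine ⟨![1, 0], ?_, ?_⟩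
    · simp; exact (mul_ne_zero_iff.mp h0).1
    · simp; exact (mul_ne_zero_iff.mp h0).2
  by_cases h1 : a 1 * b 1 ≠ 0
  · refine ⟨![0, 1], ?_, ?_⟩
    · simp; exact (mul_ne_zero_iff.mp h1).1
    · simp; exact (mul_ne_zero_iff.mp h1).2
  push Not at h0 h1
  refine ⟨![1, 1], ?_, ?_⟩ <;> simp
  · rcases mul_eq_zero.mp h0 with ha0 | hb0
    · have ha1 : a 1 ≠ 0 := by
        intro ha1; apply hab; rw [ha0, ha1]; ring
      rw [ha0, zero_add]; exact ha1
    · have ha0' : a 0 ≠ 0 := by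
        intro ha0; apply hab; rw [ha0, hb0]; ring
      rcases mul_eq_zero.mp h1 with ha1 | hb1
      · rw [ha1, add_zero]; exact ha0'
      · exfalso; apply hab; rw [hb0, hb1]; ring
  · rcases mul_eq_zero.mp h0 with ha0 | hb0
    · have hb0' : b 0 ≠ 0 := by
        intro hb0; apply hab; rw [ha0, hb0]; ring
      rcases mul_eq_zero.mp h1 with ha1 | hb1
      · exfalso; apply hab; rw [ha0, ha1]; ring
      · rw [hb1, add_zero]; exact hb0'
    · have hb1 : b 1 ≠ 0 := by
        intro hb1; apply hab; rw [hb0, hb1]; ring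
      rw [hb0, zero_add]; exact hb1

/-- The real multiple `t ζ` of a direction. -/
def zt (ζ : Fin 2 → ℂ) (t : ℝ) : Fin 2 → ℂ := fun k => (t : ℂ) * ζ k

/-- `ℓ_{tζ}(y) = t (ζ^* y_{01}) − y₂` for real `t`. -/
theorem ell_zt (ζ : Fin 2 → ℂ) (t : ℝ) (y : Fin 3 → ℂ) :
    ell (zt ζ t) y = (t : ℂ) * (conj (ζ 0) * y 0 + conj (ζ 1) * y 1) - y 2 := by
  simp [ell_eq, zt, map_mul, Complex.conj_ofReal]
  ring

/-- `|t ζ|² = t² |ζ|²`. -/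
theorem nsq_zt (ζ : Fin 2 → ℂ) (t : ℝ) : nsq (zt ζ t) = t ^ 2 * nsq ζ := by
  simp [nsq, zt, Complex.norm_real, Real.norm_eq_abs, mul_pow, sq_abs]
  ring

/-- `0 · ζ = 0`. -/
theorem zt_zero (ζ : Fin 2 → ℂ) : zt ζ 0 = 0 := by
  funext k; simp [zt]

/-- `t ↦ t ζ` is continuous. -/
theorem continuous_zt (ζ : Fin 2 → ℂ) : Continuous (zt ζ) := by
  unfold zt
  fun_prop

/-- Continuity of `t ↦ (1 − |t ζ|²)⁻¹` at `t = 0`. -/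
theorem continuousAt_inv_one_sub_nsq_zt (ζ : Fin 2 → ℂ) :
    ContinuousAt (fun t : ℝ => (((1 - nsq (zt ζ t))⁻¹ : ℝ) : ℂ)) 0 := by
  refine Complex.continuous_ofReal.continuousAt.comp ?_
  refine ContinuousAt.inv₀ ((continuous_const.sub (continuous_nsq.comp (continuous_zt ζ))).continuousAt) ?_
  simp [zt_zero, nsq]

/-- `t ↦ ℓ_{tζ}(y)` is continuous. -/
theorem continuousAt_ell_zt (ζ : Fin 2 → ℂ) (y : Fin 3 → ℂ) : Continuous (fun t : ℝ => ell (zt ζ t) y) := by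
  simp only [ell_zt]
  fun_prop

/-- Continuity of the `D`-factor along `t ζ` at `t = 0`. -/
theorem continuousAt_Dfac_zt (a b : Fin 3 → ℂ) (ζ : Fin 2 → ℂ) :
    ContinuousAt (fun t : ℝ => Dfac a b (zt ζ t)) 0 := by
  unfold Dfac
  have h1 := continuousAt_inv_one_sub_nsq_zt ζ
  have h2 := (continuousAt_ell_zt ζ a).continuousAt (x := (0 : ℝ))
  have h3 := (continuousAt_ell_zt ζ b).continuousAt (x := (0 : ℝ))
  have hz : ∀ k, Continuous (fun t : ℝ => conj (zt ζ t k)) := fun k =>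
    Complex.continuous_conj.comp ((continuous_apply k).comp (continuous_zt ζ))
  exact continuousAt_const.add (h1.mul (((Complex.continuous_conj.continuousAt.comp h3).mul
    ((continuousAt_const.mul (hz 1).continuousAt).sub (continuousAt_const.mul (hz 0).continuousAt))).add
    ((Complex.continuous_conj.continuousAt.comp h2).mul (((hz 0).continuousAt.mul continuousAt_const).sub
    ((hz 1).continuousAt.mul continuousAt_const)))))

/-- The `D`-factor at `z = 0` is `conj (a₀ b₁ − a₁ b₀)`. -/
theorem Dfac_zt_zero (a b : Fin 3 → ℂ) (ζ : Fin 2 → ℂ) : Dfac a b (zt ζ 0) = conj (a 0 * b 1 - a 1 * b 0) := by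
  simp [Dfac, zt_zero, nsq]

/-- `nondeg` for `Φ_∂`: for `a, b` with independent first two coordinates the wedge is non-zero at some point of the
ball — at a small real multiple `t ζ` of a direction on which `ℓ_{tζ}(a)`, `ℓ_{tζ}(b)` and the `D`-factor are all
non-zero (the `D`-factor tends to `conj (a₀ b₁ − a₁ b₀) ≠ 0`). -/
theorem PhiDel_nondeg (a b : Fin 3 → ℂ) (hab : a 0 * b 1 - a 1 * b 0 ≠ 0) :
    ∃ z ∈ ball, wedge (datumS PhiDel a z) (datumS PhiDel b z) ≠ 0 := by
  obtain ⟨ζ, hpa, hpb⟩ := exists_direction a b hab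
  -- the four eventual conditions along `t ζ`, `t → 0`, `t ≠ 0`
  have hball : ∀ᶠ t : ℝ in nhdsWithin 0 {0}ᶜ, zt ζ t ∈ ball := by
    refine Filter.Eventually.filter_mono nhdsWithin_le_nhds ?_
    have : Filter.Tendsto (fun t : ℝ => nsq (zt ζ t)) (nhds 0) (nhds (nsq (zt ζ 0))) :=
      (continuous_nsq.comp (continuous_zt ζ)).continuousAt
    rw [zt_zero] at this
    have h0 : nsq (0 : Fin 2 → ℂ) = 0 := by simp [nsq]
    rw [h0] at this
    exact this.eventually_lt_const one_pos
  have hella : ∀ᶠ t : ℝ in nhdsWithin 0 {0}ᶜ, ell (zt ζ t) a ≠ 0 := by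
    by_cases ha2 : a 2 = 0
    · filter_upwards [self_mem_nhdsWithin] with t ht
      rw [ell_zt, ha2, sub_zero]
      exact mul_ne_zero (Complex.ofReal_ne_zero.mpr ht) hpa
    · refine Filter.Eventually.filter_mono nhdsWithin_le_nhds ?_
      have : Filter.Tendsto (fun t : ℝ => ell (zt ζ t) a) (nhds 0) (nhds (ell (zt ζ 0) a)) :=
        (continuousAt_ell_zt ζ a).continuousAt
      refine this.eventually_ne ?_
      rw [ell_zt]
      simpa using ha2
  have hellb : ∀ᶠ t : ℝ in nhdsWithin 0 {0}ᶜ, ell (zt ζ t) b ≠ 0 := by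
    by_cases hb2 : b 2 = 0
    · filter_upwards [self_mem_nhdsWithin] with t ht
      rw [ell_zt, hb2, sub_zero]
      exact mul_ne_zero (Complex.ofReal_ne_zero.mpr ht) hpb
    · refine Filter.Eventually.filter_mono nhdsWithin_le_nhds ?_
      have : Filter.Tendsto (fun t : ℝ => ell (zt ζ t) b) (nhds 0) (nhds (ell (zt ζ 0) b)) :=
        (continuousAt_ell_zt ζ b).continuousAt
      refine this.eventually_ne ?_
      rw [ell_zt]
      simpa using hb2
  have hD : ∀ᶠ t : ℝ in nhdsWithin 0 {0}ᶜ, Dfac a b (zt ζ t) ≠ 0 := by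
    refine Filter.Eventually.filter_mono nhdsWithin_le_nhds ?_
    refine (continuousAt_Dfac_zt a b ζ).eventually_ne ?_
    rw [Dfac_zt_zero]
    exact (map_ne_zero _).mpr hab
  obtain ⟨t, hzt, ha, hb, hDt⟩ := (hball.and (hella.and (hellb.and hD))).exists
  refine ⟨zt ζ t, hzt, ?_⟩
  rw [wedge_datumS_PhiDel]
  have hpos := one_sub_nsq_pos hzt
  refine mul_ne_zero (mul_ne_zero (mul_ne_zero (mul_ne_zero (mul_ne_zero ?_ ?_) ?_) ?_) (mul_ne_zero ha hb)) hDt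
  · exact_mod_cast (Real.exp_pos _).ne'
  · exact_mod_cast (Real.exp_pos _).ne'
  · exact_mod_cast (by positivity : (4 * Real.pi ^ 2 : ℝ) ≠ 0)
  · exact pow_ne_zero _ (by exact_mod_cast (inv_pos.mpr hpos).ne')

end Summit.Ventures.HodgeRepro.Tier4.Line3
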